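import Summits.Ventures.LatticeQCDFlow.Scoring.MomentumLawSymmetry
import Summits.Ventures.LatticeQCDFlow.Scoring.WilsonFlowRK3Consistency
import Summits.Ventures.LatticeQCDFlow.Scoring.SymmetricSamplerOddObservables
import Literature.MathematicalPhysics.QuantumFieldTheory.WilsonEnergyConvexity
import HarnessLib

/-!
# The HMC kernel of arm E2 — Gaussian momentum refresh, any kick–drift trajectory, Metropolis test — commutes with the time reflection and is gauge covariant; hence `E[Q] = 0` for the MEASURED flowed clover charge at EVERY Markov step from a cold or hot start

HONEST FRAMING: exact (Metropolis-corrected) sampling algorithms for lattice gauge theory;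
figures of merit are autocorrelation/cost numbers at stated couplings and volumes; no
continuum-physics claim.

Venture `LatticeQCDFlow` (cell pub-lqcd), sub-topic `Scoring`; FANOUT row 16 (`su2-base`, arm E2 = HMC with the
engine's OMF4 integrator, `τ = 1`, scored on `τ_int(Q)` of the RK3-flowed clover charge; run check `⟨Q⟩ = 0`).
It assembles the gen-2/gen-4 symmetry packet into the statement about the SAMPLER that
`SymmetricSamplerOddObservables` left open ("WHICH samplers are symmetric is NOT claimed"):
`KickDriftSymmetry` (every kick–drift word is equivariant under the lifted `Θ'`, `ΔH` invariant),
`MomentumLawSymmetry` (the momentum draw is invariant under the transport `reflReg U`),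
`WilsonFlowRK3Reflection` (the measured flowed charge is `Θ'`-odd), `WilsonFlowRK3Consistency` (continuity of
the register calculus), the Literature's `continuous_wilsonAction_of_continuous` and `WilsonSiteRPForm`
(`negReflectEquiv`), and row 7's `Exactness/TransformedKernel` (`conjKernel`, `nHit`).  NEW WORK of the cell;
nothing is cited as a fact; no number.  Printed counterpart, NAMED ONLY: Duane–Kennedy–Pendleton–Roweth 1987.

## What is here (every `d ≥ 1`, `L ≥ 1`, `n`, coupling `β`, MD step `ε`, word `w`, basis `B : SuBasis n`)

* §1 `continuous_mdOp_apply`, `continuous_mdWord`, `continuous_kinetic`, `continuous_momOf`.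
* §2 `wilsonH β = β S_W + K`, `energyChange` (`ΔH` of the trajectory `w` from `(U, Σ c Tᵃ)`), **`hmcStep`** —
  one HMC update as a deterministic function of the configuration and of its randomness `(c, u)`
  (momentum coefficients, uniform): accept the trajectory's end point iff `u ≤ e^{−ΔH}` — `hmcNoise =
  N(0,1)^{⊗(E×ι)} ⊗ U[0,1]` (a probability measure), and **`hmcKernel B β ε w`**, a MARKOV kernel on
  `SU(n)` configurations (`Kernel.map (id ×ₖ const noise) hmcStep`; `hmcKernel_apply`: `κ(U)` is the law of
  `hmcStep U (c,u)`); `continuous_energyChange`, `measurable_hmcStep`.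
* §3 **`hmcStep_negReflect`**: `hmcStep (Θ'U) (O_U c, u) = Θ'(hmcStep U (c, u))` with `O_U` the coordinate
  form of `reflReg U`; the noise transport `(c,u) ↦ (O_U c, u)` is measure preserving; hence
  **`hmcKernel_negReflect`**: `κ(Θ'U) = Θ'_* κ(U)` and **`conjKernel_hmcKernel`**: `conjKernel κ Θ' = κ`.
  §3b the same template for gauge transformations: `hmcStep_gaugeTransform`, **`hmcKernel_gaugeTransform`**:
  `κ(U^g) = (·)^g_* κ(U)`.
* §4 (`d = 4`) **`integral_rk3CloverCharge_hmcChain_eq_zero`**: from ANY `Θ'`-invariant initial law, at EVERY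
  step `N` of the chain `μ₀ κᴺ`, the measured flowed charge `Q_{ε',m} = Σ_x P_x ∘ RK3_{ε'}^m` has mean `0`
  (no integrability needed); `rk3CloverCharge_hmcChain_tail_symm` (symmetric tails); the engine's two starts:
  **`integral_rk3CloverCharge_hmcColdStart_eq_zero`** (`U ≡ 1`) and
  **`integral_rk3CloverCharge_hmcHotStart_eq_zero`** (`∏ dHaar`).  So for arm E2 a measured `⟨Q⟩ ≠ 0`
  beyond errors indicts the implementation or the estimator — never the algorithm, at any finite Markov
  time, volume, coupling, step sizes or trajectory word.

NOT here: arm E1 (heat bath + over-relaxation in a fixed lexicographic sweep ORDER is not `Θ'`-symmetric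
as an ordered product — only its constituent link updates are); stationarity / detailed balance of `κ`
(reversibility of palindromic words is row 9's `Exactness/SplittingWords`; volume preservation on `SU(n)^E`
is not typed here); translations of the kernel (same template with `transRegₗ`); floating point; any number.
-/

noncomputable section

open Matrix MeasureTheory ProbabilityTheory ProbabilityTheory.Kernel Filter Topology
open Literature.MathematicalPhysics.QuantumFieldTheory
open Literature.MathematicalPhysics.QuantumFieldTheory.Luscher2010 (SuBasis)
open Literature.MathematicalPhysics.QuantumLattice (fundamentalRep continuous_fundamentalRep
  fundamentalRep_mem_unitaryGroup cloverPseudoscalar)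
open Summit.Ventures.LatticeQCDFlow.Exactness (conjKernel conjKernel_apply nHit)

namespace Summit.Ventures.LatticeQCDFlow.Scoring

variable {d L n : ℕ}

/-! ## §1 Continuity of words, of the kinetic energy and of the momentum assembly -/

section Continuity

variable [NeZero L]

/-- Every MD instruction is a continuous map of phase space. -/
theorem continuous_mdOp_apply (ε : ℝ) (op : MDOp) : Continuous (op.apply (d := d) (L := L) (n := n) ε) := by
  cases op with
  | kick c =>
      show Continuous fun z : MDPhase d L n => (MDOp.kick c).apply ε z
      simp only [MDOp.apply]
      exact continuous_fst.prodMk (continuous_rkRegister c 1 continuous_const continuous_snd continuous_fst)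
  | drift a =>
      show Continuous fun z : MDPhase d L n => (MDOp.drift a).apply ε z
      simp only [MDOp.apply]
      have hX : Continuous fun z : MDPhase d L n => (a * ε) • z.2 := continuous_snd.const_smul (a * ε)
      exact (continuous_rkPush (Xf := fun z : MDPhase d L n => (a * ε) • z.2) (Wf := fun z : MDPhase d L n => z.1)
        hX continuous_fst).prodMk continuous_snd

/-- Every kick–drift word is a continuous map of phase space. -/
theorem continuous_mdWord (ε : ℝ) (w : List MDOp) : Continuous (mdWord (d := d) (L := L) (n := n) ε w) := by
  induction w with
  | nil => exact continuous_id
  | cons op w ih => exact ih.comp (continuous_mdOp_apply ε op)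

/-- The kinetic energy is continuous. -/
theorem continuous_kinetic : Continuous (kinetic (d := d) (L := L) (n := n)) := by
  unfold kinetic
  refine continuous_finsetSum _ fun e _ => ?_
  have h : Continuous fun P : Edge d L → suAlgebra n => ((P e : suAlgebra n) : Matrix (Fin n) (Fin n) ℂ) :=
    continuous_subtype_val.comp (continuous_apply e)
  exact Complex.continuous_re.comp ((h.matrix_conjTranspose.mul h).matrix_trace)

omit [NeZero L] in
/-- The momentum assembly `c ↦ Σ_a c(e,a) Tᵃ` is continuous. -/
theorem continuous_momOf (B : SuBasis n) : Continuous (momOf B (d := d) (L := L)) := by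
  refine continuous_pi fun e => Continuous.subtype_mk ?_ _
  refine continuous_finsetSum _ fun a _ => ?_
  exact (Complex.continuous_ofReal.comp (continuous_apply (e, a))).smul continuous_const

end Continuity

/-! ## §2 The HMC update as a deterministic function of (configuration, momentum coefficients, uniform) -/

section Kernel

variable [NeZero L] (B : SuBasis n) (β ε : ℝ) (w : List MDOp)

/-- The MD Hamiltonian of the Wilson theory, `H(U, P) = β S_W(U) + K(P)`. -/
def wilsonH (β : ℝ) (z : MDPhase d L n) : ℝ :=
  mdHamiltonian (fun U : GaugeConfig d L (Matrix.specialUnitaryGroup (Fin n) ℂ) => β * wilsonAction (fundamentalRep (Fin n)) U) z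

/-- The energy change of the trajectory `w` at step size `ε` from `(U, Σ c Tᵃ)`. -/
def energyChange (U : GaugeConfig d L (Matrix.specialUnitaryGroup (Fin n) ℂ)) (c : Edge d L × B.ι → ℝ) : ℝ :=
  wilsonH β (mdWord ε w (U, momOf B c)) - wilsonH β (U, momOf B c)

/-- **One HMC update as a function of its randomness**: momentum coefficients `c` (to be drawn i.i.d.
`N(0,1)`) and a uniform `u ∈ [0,1]`; accept the end point of the trajectory iff `u ≤ e^{−ΔH}`. -/
def hmcStep (U : GaugeConfig d L (Matrix.specialUnitaryGroup (Fin n) ℂ)) (r : (Edge d L × B.ι → ℝ) × ℝ) :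
    GaugeConfig d L (Matrix.specialUnitaryGroup (Fin n) ℂ) :=
  if r.2 ≤ Real.exp (-energyChange B β ε w U r.1) then (mdWord ε w (U, momOf B r.1)).1 else U

/-- The law of the randomness: i.i.d. standard normal coefficients and an independent uniform on `[0,1]`. -/
def hmcNoise : Measure ((Edge d L × B.ι → ℝ) × ℝ) :=
  (Measure.pi fun _ : Edge d L × B.ι => gaussianReal 0 1).prod ((volume : Measure ℝ).restrict (Set.Icc 0 1))

/-- The noise law is s-finite (needed for the product-kernel instances). -/
instance sFinite_hmcNoise : SFinite (hmcNoise B (d := d) (L := L)) := by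
  unfold hmcNoise; infer_instance

/-- **The HMC transition kernel of arm E2** (momentum refresh + trajectory `w` + Metropolis test), as a Markov
kernel on configurations: `κ(U) = law of hmcStep U (c, u)`. -/
def hmcKernel : Kernel (GaugeConfig d L (Matrix.specialUnitaryGroup (Fin n) ℂ))
    (GaugeConfig d L (Matrix.specialUnitaryGroup (Fin n) ℂ)) :=
  Kernel.map (Kernel.id ×ₖ Kernel.const _ (hmcNoise B)) (fun z => hmcStep B β ε w z.1 z.2)

/-- `(U, c) ↦ ΔH` is continuous. -/
theorem continuous_energyChange :
    Continuous fun p : GaugeConfig d L (Matrix.specialUnitaryGroup (Fin n) ℂ) × (Edge d L × B.ι → ℝ) =>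
      energyChange B β ε w p.1 p.2 := by
  have hH : Continuous (wilsonH (d := d) (L := L) (n := n) β) := by
    unfold wilsonH mdHamiltonian
    exact ((continuous_const.mul ((continuous_wilsonAction_of_continuous (fundamentalRep (Fin n))
      (continuous_fundamentalRep (Fin n))).comp continuous_fst))).add (continuous_kinetic.comp continuous_snd)
  have hz : Continuous fun p : GaugeConfig d L (Matrix.specialUnitaryGroup (Fin n) ℂ) × (Edge d L × B.ι → ℝ) =>
      ((p.1, momOf B p.2) : MDPhase d L n) := continuous_fst.prodMk ((continuous_momOf B).comp continuous_snd)
  unfold energyChange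
  exact (hH.comp ((continuous_mdWord ε w).comp hz)).sub (hH.comp hz)

/-- The uncurried update is measurable. -/
theorem measurable_hmcStep :
    Measurable fun z : GaugeConfig d L (Matrix.specialUnitaryGroup (Fin n) ℂ) × ((Edge d L × B.ι → ℝ) × ℝ) =>
      hmcStep B β ε w z.1 z.2 := by
  unfold hmcStep
  refine Measurable.ite ?_ ?_ measurable_fst
  · refine measurableSet_le (measurable_snd.comp measurable_snd) ?_
    exact Real.continuous_exp.measurable.comp
      (((continuous_energyChange (d := d) (L := L) B β ε w).measurable.comp
        (measurable_fst.prodMk (measurable_fst.comp measurable_snd))).neg)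
  · have hz : Continuous fun z : GaugeConfig d L (Matrix.specialUnitaryGroup (Fin n) ℂ) × ((Edge d L × B.ι → ℝ) × ℝ) =>
        ((z.1, momOf B z.2.1) : MDPhase d L n) :=
      continuous_fst.prodMk ((continuous_momOf B).comp (continuous_fst.comp continuous_snd))
    exact (continuous_fst.comp ((continuous_mdWord ε w).comp hz)).measurable

/-- For fixed `U`, the update is a measurable function of the randomness. -/
theorem measurable_hmcStep_right (U : GaugeConfig d L (Matrix.specialUnitaryGroup (Fin n) ℂ)) :
    Measurable (hmcStep B β ε w U) :=
  (measurable_hmcStep B β ε w).comp (measurable_const.prodMk measurable_id)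

/-- **`κ(U)` is the law of `hmcStep U (c, u)` under the noise.** -/
theorem hmcKernel_apply (U : GaugeConfig d L (Matrix.specialUnitaryGroup (Fin n) ℂ)) :
    hmcKernel B β ε w U = (hmcNoise B).map (hmcStep B β ε w U) := by
  rw [hmcKernel, Kernel.map_apply _ (measurable_hmcStep B β ε w), Kernel.prod_apply, Kernel.id_apply,
    Kernel.const_apply, Measure.dirac_prod, Measure.map_map (measurable_hmcStep B β ε w) measurable_prodMk_left]
  rfl

/-- The noise law is a probability measure (`N(0,1)^{E×ι} ⊗ U[0,1]`). -/
instance isProbabilityMeasure_hmcNoise : IsProbabilityMeasure (hmcNoise B (d := d) (L := L)) := by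
  haveI : IsProbabilityMeasure ((volume : Measure ℝ).restrict (Set.Icc (0 : ℝ) 1)) :=
    ⟨by rw [Measure.restrict_apply_univ, Real.volume_Icc, sub_zero, ENNReal.ofReal_one]⟩
  unfold hmcNoise
  infer_instance

/-- **The HMC kernel is a Markov kernel** (a genuine transition probability). -/
instance isMarkovKernel_hmcKernel : IsMarkovKernel (hmcKernel B β ε w (d := d) (L := L)) := by
  unfold hmcKernel
  exact IsMarkovKernel.map _ (measurable_hmcStep B β ε w)

end Kernel

/-! ## §3 The kernel commutes with the time reflection -/

section Reflection

variable [NeZero d] [NeZero L] (B : SuBasis n) (β ε : ℝ) (w : List MDOp)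

/-- **The update intertwines the reflection**: running the update from `Θ'U` with the TRANSPORTED momentum
coefficients and the same uniform gives the reflection of the update from `U`:
`hmcStep (Θ'U) (O_U c, u) = Θ'(hmcStep U (c, u))`, `O_U = coordMap (reflReg U)` — the trajectory is
equivariant (`mdWord_reflPhase`) and `ΔH` is invariant (`wilson_energyChange_reflPhase`). -/
theorem hmcStep_negReflect (U : GaugeConfig d L (Matrix.specialUnitaryGroup (Fin n) ℂ))
    (c : Edge d L × B.ι → ℝ) (u : ℝ) :
    hmcStep B β ε w U.negReflect (coordMap B (reflRegₗ U) c, u) = (hmcStep B β ε w U (c, u)).negReflect := by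
  have hmom : momOf B (coordMap B (reflRegₗ U) c) = reflReg U (momOf B c) := (apply_momOf B (reflRegₗ U) c).symm
  have hword : mdWord ε w (U.negReflect, reflReg U (momOf B c)) = reflPhase (mdWord ε w (U, momOf B c)) :=
    mdWord_reflPhase ε w (U, momOf B c)
  have hΔ : energyChange B β ε w U.negReflect (coordMap B (reflRegₗ U) c) = energyChange B β ε w U c := by
    unfold energyChange wilsonH
    rw [hmom]
    exact wilson_energyChange_reflPhase β ε w (U, momOf B c)
  unfold hmcStep
  simp only [hΔ]
  split_ifs with h
  · rw [hmom, hword]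
    rfl
  · rfl

/-- The transport of the noise `(c, u) ↦ (O_U c, u)` preserves its law. -/
theorem measurePreserving_noise_transport (U : GaugeConfig d L (Matrix.specialUnitaryGroup (Fin n) ℂ)) :
    MeasurePreserving (Prod.map (coordMeasurableEquiv B (reflRegₗ U) (kinetic_reflReg U)) id)
      (hmcNoise B (d := d) (L := L)) (hmcNoise B) :=
  (measurePreserving_coordMap B (reflRegₗ U) (kinetic_reflReg U)).prod (MeasurePreserving.id _)

/-- **The HMC kernel commutes with `Θ'`**: `κ(Θ'U) = Θ'_* κ(U)`. -/
theorem hmcKernel_negReflect (U : GaugeConfig d L (Matrix.specialUnitaryGroup (Fin n) ℂ)) :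
    hmcKernel B β ε w U.negReflect = (hmcKernel B β ε w U).map GaugeConfig.negReflect := by
  rw [hmcKernel_apply, hmcKernel_apply]
  have hT := measurePreserving_noise_transport B U
  have hmeasT : Measurable (Prod.map (coordMeasurableEquiv B (reflRegₗ U) (kinetic_reflReg U)) id :
      ((Edge d L × B.ι → ℝ) × ℝ) → (Edge d L × B.ι → ℝ) × ℝ) := hT.measurable
  have hfun : hmcStep B β ε w U.negReflect ∘ Prod.map (coordMeasurableEquiv B (reflRegₗ U) (kinetic_reflReg U)) id =
      GaugeConfig.negReflect ∘ hmcStep B β ε w U := by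
    funext r
    obtain ⟨c, u⟩ := r
    simp only [Function.comp_apply, Prod.map_apply, id_eq, coordMeasurableEquiv_apply]
    exact hmcStep_negReflect B β ε w U c u
  calc (hmcNoise B).map (hmcStep B β ε w U.negReflect)
      = ((hmcNoise B).map (Prod.map (coordMeasurableEquiv B (reflRegₗ U) (kinetic_reflReg U)) id)).map
          (hmcStep B β ε w U.negReflect) := by rw [hT.map_eq]
    _ = (hmcNoise B).map (hmcStep B β ε w U.negReflect ∘
          Prod.map (coordMeasurableEquiv B (reflRegₗ U) (kinetic_reflReg U)) id) :=
        Measure.map_map (measurable_hmcStep_right B β ε w _) hmeasT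
    _ = (hmcNoise B).map (GaugeConfig.negReflect ∘ hmcStep B β ε w U) := by rw [hfun]
    _ = ((hmcNoise B).map (hmcStep B β ε w U)).map GaugeConfig.negReflect :=
        (Measure.map_map WilsonSiteRP.measurable_negReflect (measurable_hmcStep_right B β ε w U)).symm

/-- **`conjKernel κ Θ' = κ`** — the form consumed by `SymmetricSamplerOddObservables`. -/
theorem conjKernel_hmcKernel :
    conjKernel (hmcKernel B β ε w) (WilsonSiteRP.negReflectEquiv (d := d) (L := L)) = hmcKernel B β ε w := by
  refine ProbabilityTheory.Kernel.ext fun U => ?_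
  rw [conjKernel_apply]
  have hsymm : (WilsonSiteRP.negReflectEquiv (d := d) (L := L)
      (G := Matrix.specialUnitaryGroup (Fin n) ℂ)).symm U = U.negReflect := rfl
  have hcoe : ((WilsonSiteRP.negReflectEquiv (d := d) (L := L) (G := Matrix.specialUnitaryGroup (Fin n) ℂ)) :
      GaugeConfig d L (Matrix.specialUnitaryGroup (Fin n) ℂ) → GaugeConfig d L (Matrix.specialUnitaryGroup (Fin n) ℂ))
      = GaugeConfig.negReflect := rfl
  rw [hsymm, hcoe, hmcKernel_negReflect, Measure.map_map WilsonSiteRP.measurable_negReflect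
    WilsonSiteRP.measurable_negReflect]
  have hid : (GaugeConfig.negReflect ∘ GaugeConfig.negReflect :
      GaugeConfig d L (Matrix.specialUnitaryGroup (Fin n) ℂ) → GaugeConfig d L (Matrix.specialUnitaryGroup (Fin n) ℂ)) =
      id := funext fun V => WilsonSiteRP.negReflect_negReflect_config V
  rw [hid, Measure.map_id]

end Reflection

/-! ## §3b The kernel is gauge covariant -/

section Gauge

variable [NeZero d] [NeZero L] (B : SuBasis n) (β ε : ℝ) (w : List MDOp) (g : Site d L → Matrix.specialUnitaryGroup (Fin n) ℂ)

omit [NeZero d] [NeZero L] in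
/-- Gauge transformations are continuous maps of the configuration space. -/
theorem continuous_gaugeTransform :
    Continuous (gaugeTransform g : GaugeConfig d L (Matrix.specialUnitaryGroup (Fin n) ℂ) →
      GaugeConfig d L (Matrix.specialUnitaryGroup (Fin n) ℂ)) := by
  unfold gaugeTransform
  fun_prop

/-- **The update intertwines gauge transformations**: `hmcStep (U^g) (Ad_g c, u) = (hmcStep U (c, u))^g`. -/
theorem hmcStep_gaugeTransform (U : GaugeConfig d L (Matrix.specialUnitaryGroup (Fin n) ℂ))
    (c : Edge d L × B.ι → ℝ) (u : ℝ) :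
    hmcStep B β ε w (gaugeTransform g U) (coordMap B (gaugeRegₗ g) c, u) =
      gaugeTransform g (hmcStep B β ε w U (c, u)) := by
  have hmom : momOf B (coordMap B (gaugeRegₗ g) c) = gaugeReg g (momOf B c) := (apply_momOf B (gaugeRegₗ g) c).symm
  have hword : mdWord ε w (gaugeTransform g U, gaugeReg g (momOf B c)) = gaugePhase g (mdWord ε w (U, momOf B c)) :=
    mdWord_gaugePhase g ε w (U, momOf B c)
  have hΔ : energyChange B β ε w (gaugeTransform g U) (coordMap B (gaugeRegₗ g) c) = energyChange B β ε w U c := by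
    unfold energyChange wilsonH
    rw [hmom]
    exact energyChange_gaugePhase (wilsonMDAction_invariances (d := d) (L := L) (n := n) β).1 g ε w (U, momOf B c)
  unfold hmcStep
  simp only [hΔ]
  split_ifs with h
  · rw [hmom, hword]
    rfl
  · rfl

/-- **The HMC kernel is gauge covariant**: `κ(U^g) = (·)^g_* κ(U)` for every `g : Λ → SU(n)`. -/
theorem hmcKernel_gaugeTransform (U : GaugeConfig d L (Matrix.specialUnitaryGroup (Fin n) ℂ)) :
    hmcKernel B β ε w (gaugeTransform g U) = (hmcKernel B β ε w U).map (gaugeTransform g) := by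
  rw [hmcKernel_apply, hmcKernel_apply]
  have hT : MeasurePreserving (Prod.map (coordMeasurableEquiv B (gaugeRegₗ g) (kinetic_gaugeReg g)) id)
      (hmcNoise B (d := d) (L := L)) (hmcNoise B) :=
    (measurePreserving_coordMap B (gaugeRegₗ g) (kinetic_gaugeReg g)).prod (MeasurePreserving.id _)
  have hfun : hmcStep B β ε w (gaugeTransform g U) ∘
      Prod.map (coordMeasurableEquiv B (gaugeRegₗ g) (kinetic_gaugeReg g)) id =
      gaugeTransform g ∘ hmcStep B β ε w U := by
    funext r
    obtain ⟨c, u⟩ := r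
    simp only [Function.comp_apply, Prod.map_apply, id_eq, coordMeasurableEquiv_apply]
    exact hmcStep_gaugeTransform B β ε w g U c u
  calc (hmcNoise B).map (hmcStep B β ε w (gaugeTransform g U))
      = ((hmcNoise B).map (Prod.map (coordMeasurableEquiv B (gaugeRegₗ g) (kinetic_gaugeReg g)) id)).map
          (hmcStep B β ε w (gaugeTransform g U)) := by rw [hT.map_eq]
    _ = (hmcNoise B).map (hmcStep B β ε w (gaugeTransform g U) ∘
          Prod.map (coordMeasurableEquiv B (gaugeRegₗ g) (kinetic_gaugeReg g)) id) :=
        Measure.map_map (measurable_hmcStep_right B β ε w _) hT.measurable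
    _ = (hmcNoise B).map (gaugeTransform g ∘ hmcStep B β ε w U) := by rw [hfun]
    _ = ((hmcNoise B).map (hmcStep B β ε w U)).map (gaugeTransform g) :=
        (Measure.map_map (continuous_gaugeTransform g).measurable (measurable_hmcStep_right B β ε w U)).symm

end Gauge

/-! ## §4 `E[Q] = 0` for the measured flowed charge at every HMC step (row 16, arm E2) -/

section Chain

variable {L n : ℕ} [NeZero L] (B : SuBasis n) (β ε : ℝ) (w : List MDOp)

/-- **At every step `N` of the HMC chain from ANY `Θ'`-invariant start, the measured flowed clover charge
`Q_{ε',m} = Σ_x P_x ∘ RK3_{ε'}^m` has mean zero** — every coupling `β`, MD step size `ε`, kick–drift word `w`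
(leapfrog, the engine's OMF4, …), basis `B`, flow step `ε'`, flow step count `m`, `L ≥ 1`, `n`. -/
theorem integral_rk3CloverCharge_hmcChain_eq_zero
    {μ₀ : Measure (GaugeConfig 4 L (Matrix.specialUnitaryGroup (Fin n) ℂ))}
    (hμ₀ : μ₀.map GaugeConfig.negReflect = μ₀) (N : ℕ) (ε' : ℝ) (m : ℕ) :
    ∫ U, ∑ x : Site 4 L, cloverPseudoscalar (fundamentalRep (Fin n)) x ((wilsonFlowRK3 ε')^[m] U)
      ∂(μ₀.bind (nHit (hmcKernel B β ε w) N)) = 0 :=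
  integral_bind_nHit_eq_zero_of_odd (conjKernel_hmcKernel B β ε w) hμ₀
    (fun U => sum_cloverPseudoscalar_iterate_wilsonFlowRK3_negReflect ε' m U) N

/-- **Symmetric tails at every step**: `(μ₀κᴺ){c ≤ Q_{ε',m}} = (μ₀κᴺ){Q_{ε',m} ≤ −c}`. -/
theorem rk3CloverCharge_hmcChain_tail_symm
    {μ₀ : Measure (GaugeConfig 4 L (Matrix.specialUnitaryGroup (Fin n) ℂ))}
    (hμ₀ : μ₀.map GaugeConfig.negReflect = μ₀) (N : ℕ) (ε' : ℝ) (m : ℕ) (c : ℝ) :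
    (μ₀.bind (nHit (hmcKernel B β ε w) N))
        {U | c ≤ ∑ x : Site 4 L, cloverPseudoscalar (fundamentalRep (Fin n)) x ((wilsonFlowRK3 ε')^[m] U)} =
      (μ₀.bind (nHit (hmcKernel B β ε w) N))
        {U | ∑ x : Site 4 L, cloverPseudoscalar (fundamentalRep (Fin n)) x ((wilsonFlowRK3 ε')^[m] U) ≤ -c} :=
  bind_nHit_tail_symm_of_odd (conjKernel_hmcKernel B β ε w) hμ₀
    (fun U => sum_cloverPseudoscalar_iterate_wilsonFlowRK3_negReflect ε' m U) N c

/-- **Cold start** (`U ≡ 1`, the engine's `start="cold"`): `E[Q_{ε',m}(U_N)] = 0` at every HMC step `N`. -/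
theorem integral_rk3CloverCharge_hmcColdStart_eq_zero (N : ℕ) (ε' : ℝ) (m : ℕ) :
    ∫ U, ∑ x : Site 4 L, cloverPseudoscalar (fundamentalRep (Fin n)) x ((wilsonFlowRK3 ε')^[m] U)
      ∂((Measure.dirac (1 : GaugeConfig 4 L (Matrix.specialUnitaryGroup (Fin n) ℂ))).bind
        (nHit (hmcKernel B β ε w) N)) = 0 :=
  integral_rk3CloverCharge_hmcChain_eq_zero B β ε w dirac_one_map_negReflect N ε' m

/-- **Hot start** (`∏ₑ dHaar`, the engine's `start="hot"`): `E[Q_{ε',m}(U_N)] = 0` at every HMC step `N`. -/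
theorem integral_rk3CloverCharge_hmcHotStart_eq_zero (N : ℕ) (ε' : ℝ) (m : ℕ) :
    ∫ U, ∑ x : Site 4 L, cloverPseudoscalar (fundamentalRep (Fin n)) x ((wilsonFlowRK3 ε')^[m] U)
      ∂((Measure.pi fun _ : Edge 4 L => haarProbability (Matrix.specialUnitaryGroup (Fin n) ℂ)).bind
        (nHit (hmcKernel B β ε w) N)) = 0 :=
  integral_rk3CloverCharge_hmcChain_eq_zero B β ε w piHaar_map_negReflect N ε' m

end Chain

end Summit.Ventures.LatticeQCDFlow.Scoring

end
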